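import Literature.MathematicalPhysics.QuantumFieldTheory.Balaban1983to89.B3LineCut
import Literature.MathematicalPhysics.QuantumFieldTheory.Balaban1983to89.B3Graph24Unique

/-!
# `Balaban1983to89.B3LineCutDivergent` — T. Bałaban, *(Higgs)₂,₃ quantum fields in a finite volume. III. Renormalization*,
Commun. Math. Phys. **88** (1983) 411–445 [Balaban1983Higgs3]: p. 432, *"most of the divergent graphs are transformed into
convergent ones, with the possible exception of graphs with one external vector field leg and vacuum graphs"* (replacing a
line by a pair of external legs), DECIDED on the concrete family of graphs `B3Cor23Concrete.Graph`, d = 3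

statement-level skeleton of published theorems with citation tags; proofs where landed; nothing here is a claim about the Yang–Mills mass gap

PDF held: `paper:balaban1983-higgs-2-3-quantum-fields-finite-volume` (journal page = PDF page + 410); p. 432 [PDF 22] read on
the OCR text and the ×2 render `run/shared/lean/pub/pub-balaban/b2b-balaban-ref1/pages/1983-cmp88-higgs23-III/1983-cmp88-higgs23-III-p022-x2.png`;
pp. 422–424, 429–430, 435 as read by the files imported.
CITATION HEADER (lean-in-tree rule).  lit-balaban TYPED SKELETON (HOME `run/shared/lean/pub/lit-balaban/`), Phase 2, seat p18
(gen 6), unit `lit-balaban-p18`: SKELETON row **B3.Eq3.2** (the reduction paragraph of Sect. 3 between (3.1) and (3.2), p. 432,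
owner r15, referee ref-4), continuing the gen-2 file `…B3LineCut` (the sentence *"if we replace a line in an arbitrary graph G
by a pair of external fields, then the degree of the new graph is greater or equal to the degree of G, thus a convergent graph is
transformed into a convergent one"*: `deg_le_deg_cutLine`, `deg_cutLine_pos`).  THIS file: the NEXT sentence, p. 432 [PDF 22],
verbatim: *"From our analysis in previous chapters it follows that most of the divergent graphs are transformed into convergent
ones, with the possible exception of graphs with one external vector field leg and vacuum graphs. These graphs occur together
with all other graphs forming a renormalized class, and inspecting all possible cases it is easily seen that if we remove a line
in any graph of the class, then for the obtained graph we can find in this class all graphs necessary to form a new renormalized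
class."*  Model: `B3Cor23Concrete` (seat p18 gen 1; admissible catalogue vertices (1.6)–(1.15), lines = the pairing «other
endpoint» of φ′/A′-legs, D_G(v) = (2.1), D(G) = (2.2)), `B3LineCut.cutLine` (gen 2: one line replaced by a pair of external legs,
another line remaining — a graph has *"at least one internal line"*, p. 415), the leg counts of `B3DivergentGraphs` (external
φ′/A′-legs `numExtLegs`, legs of the external field Ã `numTildeLegs`, counted among the external legs of the pictures, legend
(1.17) p. 415), and *"There is only one graph with four external legs and it is the graph (2.4)"* (`B3Graph24Unique.graph24_unique`).

WHAT THIS MODULE PROVES (sorry-free; `def`s with bodies: the hit counts `hitS`/`hitV`/`diffHit`/`ndiff` of a line at a vertex;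
no `Prop` fact introduced).
(1) THE EXACT EFFECT OF REPLACING ONE LINE BY A PAIR OF EXTERNAL LEGS, every dimension d, graphs without vertices of the form
(1.14)–(1.15) (`deg_cutLine_eq`): `D(G′) = D(G) + (d − 2) + (number of differentiations acting on the line)` — each of the two
endpoint legs gains (d−2)/2 ((2.1): a leg has dimension −(d−2)/2, an external field 0) and each differentiation taken off the line
gains 1; and `E(G′) = E(G) + 2` (`numExtLegs_cutLine`), the Ã-legs unchanged.  Bookkeeping: `intScalar_cutLine_add`,
`intVector_cutLine_add`, `intDiffs_cutLine_add`, `sum_hit` (the two endpoints are two distinct legs).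
(2) THE PRINTED SENTENCE, d = 3, n̄ ≥ 1 (`deg_cutLine_pos_or`, `cutLine_pos_or_is24`): if `D(G) ≤ 0` and G has at least two external
legs (Ã-legs counted) — i.e. G is neither a vacuum graph nor a graph with one external (vector) leg — then for EVERY line whose
replacement leaves a graph, the new graph G′ has `D(G′) > 0`, OR it has four external legs and `D(G′) = 0`, i.e. G′ IS the graph
(2.4) (two vertices (1.8) with n + n′ = 1 joined through their differentiated legs; this happens exactly when a two-leg
self-energy graph of lowest order is cut at its undifferentiated line, e.g. (3.6) = `g36a` cut at its A′-line, sibling file).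
Ingredients: with three or more external legs a divergent graph has `D(G) > −1` (`neg_one_lt_deg_of_three_le_ext`; the one-vertex
case `ext_le_two_of_nV_eq_one`), so `D(G′) ≥ D(G) + 1 > 0`; with two external legs `E(G′) + Ã = 4` and `graph24_unique` applies.
READING NOTE (HOME/GAPS.md): the print's dichotomy divergent/convergent is by the sign of D; the outcome (2.4) (D = 0) is the
third possibility on the model — it is the graph Proposition 2.1 admits among the subgraphs (*"with the possible exception of
the subgraphs (2.4)"*, p. 424), so *"most … are transformed into convergent ones"* is exact up to (2.4).
(3) In the sibling `…B3LineCutDivergentWitnesses`: THE PRINTED EXCEPTIONS ARE REAL on the model (a vacuum graph with D = −2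
whose cut has D = −1; a one-external-vector-leg graph with D = −1 whose cut has D = 0 and three external legs) and the third
outcome occurs ((3.6) cut at its A′-line is the graph (2.4), D = 0).
NOT here: the class-formation half of the sentence (*"we can find in this class all graphs necessary to form a new renormalized
class"*) — the classes G_ren are prose (row B3.Txt@430).
-/

namespace Literature.MathematicalPhysics.QuantumFieldTheory.Balaban1983to89.B3LineCutDivergent

open Finset B3Prop1 B3Sect2Statements B3VertexBridge B3Cor23Concrete B3DivergentGraphs B3LineCut

variable {nbar : ℕ} (G : Graph nbar)

/-! ## The endpoints of a line at a vertex -/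

/-- The number of φ′-legs of the vertex `i` among the two endpoints `a`, `b` of a line (0, 1 or 2).
[cite: Balaban1983Higgs3, (2.1) p.422] -/
def hitS (a b : Leg G.kind) (i : Fin G.nV) : ℕ :=
  (univ.filter fun j : Fin (G.kind i).scalarLegs =>
    (⟨i, .inl j⟩ : Leg G.kind) = a ∨ (⟨i, .inl j⟩ : Leg G.kind) = b).card

/-- The number of A′-legs of the vertex `i` among the two endpoints `a`, `b` of a line. [cite: Balaban1983Higgs3, (2.1) p.422] -/
def hitV (a b : Leg G.kind) (i : Fin G.nV) : ℕ :=
  (univ.filter fun j : Fin (G.kind i).vectorLegs =>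
    (⟨i, .inr j⟩ : Leg G.kind) = a ∨ (⟨i, .inr j⟩ : Leg G.kind) = b).card

/-- The number of differentiations of the vertex `i` acting on the line with endpoints `a`, `b` (the D^η_B̃ of (1.8)/(1.9) sits on
the first φ′-leg, leg 0 of the model). [cite: Balaban1983Higgs3, (2.1) p.422] -/
def diffHit (a b : Leg G.kind) (i : Fin G.nV) : ℕ :=
  if h0 : 0 < (G.kind i).scalarLegs then
    (if (⟨i, .inl ⟨0, h0⟩⟩ : Leg G.kind) = a ∨ (⟨i, .inl ⟨0, h0⟩⟩ : Leg G.kind) = b then (G.kind i).diffCount else 0)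
  else 0

/-- The number of differentiations of G acting on the line with endpoints `a`, `b` (0, 1 or 2). [cite: Balaban1983Higgs3, (2.1) p.422] -/
def ndiff (a b : Leg G.kind) : ℕ := ∑ i, diffHit G a b i

variable {a b : Leg G.kind}

/-- kernel: the first endpoint of the line is an internal leg of G. [cite: Balaban1983Higgs3, p.415] -/
theorem isSome_fst (hab : G.other a = some b) : (G.other a).isSome = true := by simp [hab]

/-- kernel: the second endpoint of the line is an internal leg of G. [cite: Balaban1983Higgs3, p.415] -/
theorem isSome_snd (hab : G.other a = some b) : (G.other b).isSome = true := by simp [G.other_symm _ _ hab]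

/-- kernel: the two endpoints of a line are distinct legs. [cite: Balaban1983Higgs3, p.415] -/
theorem fst_ne_snd (hab : G.other a = some b) : a ≠ b := (G.other_ne a b hab).symm

/-- kernel: in the graph with the line replaced by two external legs, a leg is internal iff it is internal in G and is not an
endpoint of the line. [cite: Balaban1983Higgs3, p.432] -/
theorem isSome_cutLine_iff (hab : G.other a = some b) (hrest : ∃ x, (x ≠ a ∧ x ≠ b) ∧ (G.other x).isSome) (x : Leg G.kind) :
    ((cutLine G a b hab hrest).other x).isSome = true ↔ (G.other x).isSome = true ∧ x ≠ a ∧ x ≠ b := by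
  have h := cutLine_other G a b hab hrest x
  by_cases hx : x ≠ a ∧ x ≠ b
  · rw [if_pos hx] at h
    rw [h]
    exact ⟨fun hs => ⟨hs, hx⟩, fun hs => hs.1⟩
  · rw [if_neg hx] at h
    constructor
    · intro hs
      rw [h] at hs
      exact (Bool.false_ne_true hs).elim
    · rintro ⟨-, h1, h2⟩
      exact (hx ⟨h1, h2⟩).elim

/-- kernel: indicator bookkeeping — a leg of G is internal iff it is internal after the cut or is one of the two endpoints, and
these cases exclude each other. [cite: Balaban1983Higgs3, p.432] -/
theorem ind_cutLine_add (hab : G.other a = some b) (hrest : ∃ x, (x ≠ a ∧ x ≠ b) ∧ (G.other x).isSome) (x : Leg G.kind) (c : ℕ) :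
    (if ((cutLine G a b hab hrest).other x).isSome then c else 0) + (if x = a ∨ x = b then c else 0)
      = (if (G.other x).isSome then c else 0) := by
  by_cases hx : x = a ∨ x = b
  · have hG : (G.other x).isSome = true := by
      rcases hx with rfl | rfl
      exacts [isSome_fst G hab, isSome_snd G hab]
    have hc : ¬ ((cutLine G a b hab hrest).other x).isSome = true := by
      rw [isSome_cutLine_iff]
      rintro ⟨-, h1, h2⟩
      rcases hx with rfl | rfl
      exacts [h1 rfl, h2 rfl]
    simp [hG, hc, hx]
  · have hiff : ((cutLine G a b hab hrest).other x).isSome = true ↔ (G.other x).isSome = true := by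
      rw [isSome_cutLine_iff]
      exact ⟨fun h => h.1, fun h => ⟨h, fun h1 => hx (Or.inl h1), fun h2 => hx (Or.inr h2)⟩⟩
    by_cases hG : (G.other x).isSome = true
    · simp [hG, hiff.mpr hG, hx]
    · have hc : ¬ ((cutLine G a b hab hrest).other x).isSome = true := fun h => hG (hiff.mp h)
      simp [hG, hc, hx]

/-- (2.1) bookkeeping: at each vertex the internal φ′-legs of G are those of the cut graph plus the endpoints of the line there.
[cite: Balaban1983Higgs3, (2.1) p.422] -/
theorem intScalar_cutLine_add (hab : G.other a = some b) (hrest : ∃ x, (x ≠ a ∧ x ≠ b) ∧ (G.other x).isSome) (i : Fin G.nV) :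
    (cutLine G a b hab hrest).intScalar i + hitS G a b i = G.intScalar i := by
  unfold Graph.intScalar hitS
  change (univ.filter fun j : Fin (G.kind i).scalarLegs =>
      ((cutLine G a b hab hrest).other ⟨i, .inl j⟩).isSome).card + _ = _
  rw [Finset.card_filter, Finset.card_filter, Finset.card_filter, ← Finset.sum_add_distrib]
  exact Finset.sum_congr rfl fun j _ => ind_cutLine_add G hab hrest ⟨i, .inl j⟩ 1

/-- (2.1) bookkeeping: the same for the A′-legs. [cite: Balaban1983Higgs3, (2.1) p.422] -/
theorem intVector_cutLine_add (hab : G.other a = some b) (hrest : ∃ x, (x ≠ a ∧ x ≠ b) ∧ (G.other x).isSome) (i : Fin G.nV) :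
    (cutLine G a b hab hrest).intVector i + hitV G a b i = G.intVector i := by
  unfold Graph.intVector hitV
  change (univ.filter fun j : Fin (G.kind i).vectorLegs =>
      ((cutLine G a b hab hrest).other ⟨i, .inr j⟩).isSome).card + _ = _
  rw [Finset.card_filter, Finset.card_filter, Finset.card_filter, ← Finset.sum_add_distrib]
  exact Finset.sum_congr rfl fun j _ => ind_cutLine_add G hab hrest ⟨i, .inr j⟩ 1

/-- (2.1) bookkeeping: the differentiations acting on internal lines of G are those of the cut graph plus those acting on the
line. [cite: Balaban1983Higgs3, (2.1) p.422] -/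
theorem intDiffs_cutLine_add (hab : G.other a = some b) (hrest : ∃ x, (x ≠ a ∧ x ≠ b) ∧ (G.other x).isSome) (i : Fin G.nV) :
    (cutLine G a b hab hrest).intDiffs i + diffHit G a b i = G.intDiffs i := by
  unfold Graph.intDiffs diffHit
  change (if h0 : 0 < (G.kind i).scalarLegs then
      (if ((cutLine G a b hab hrest).other ⟨i, .inl ⟨0, h0⟩⟩).isSome then (G.kind i).diffCount else 0) else 0) + _ = _
  by_cases h0 : 0 < (G.kind i).scalarLegs
  · rw [dif_pos h0, dif_pos h0, dif_pos h0]
    exact ind_cutLine_add G hab hrest _ _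
  · rw [dif_neg h0, dif_neg h0, dif_neg h0]

/-- kernel: the two endpoints of the line are two distinct legs — summed over the vertices the hit counts give 2.
[cite: Balaban1983Higgs3, p.415] -/
theorem sum_hit (hab : G.other a = some b) : ∑ i, (hitS G a b i + hitV G a b i) = 2 := by
  have h1 : ∑ i, (hitS G a b i + hitV G a b i) = (univ.filter fun x : Leg G.kind => x = a ∨ x = b).card := by
    rw [Finset.card_filter, Fintype.sum_sigma]
    refine Finset.sum_congr rfl fun i _ => ?_
    rw [Fintype.sum_sum_type, hitS, hitV, Finset.card_filter, Finset.card_filter]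
  have h2 : (univ.filter fun x : Leg G.kind => x = a ∨ x = b) = {a, b} := by
    ext x; simp
  rw [h1, h2, Finset.card_pair (fst_ne_snd G hab)]

/-- **p. 432**, the count of external legs: replacing one line by a pair of external legs gives exactly two more external legs,
`E(G′) = E(G) + 2` (φ′/A′-legs; the Ã-legs are unchanged, `numTildeLegs_cutLine`). [cite: Balaban1983Higgs3, p.432] -/
theorem numExtLegs_cutLine (hab : G.other a = some b) (hrest : ∃ x, (x ≠ a ∧ x ≠ b) ∧ (G.other x).isSome) : (cutLine G a b hab hrest).numExtLegs = G.numExtLegs + 2 := by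
  have key : ∀ i : Fin G.nV, (cutLine G a b hab hrest).extLegs i = G.extLegs i + (hitS G a b i + hitV G a b i) := by
    intro i
    have hs := intScalar_cutLine_add G hab hrest i
    have hv := intVector_cutLine_add G hab hrest i
    have hs' := G.intScalar_le i
    have hv' := G.intVector_le i
    unfold Graph.extLegs
    change ((G.kind i).scalarLegs - (cutLine G a b hab hrest).intScalar i)
      + ((G.kind i).vectorLegs - (cutLine G a b hab hrest).intVector i) = _
    omega
  unfold Graph.numExtLegs
  change ∑ i : Fin G.nV, (cutLine G a b hab hrest).extLegs i = ∑ i : Fin G.nV, G.extLegs i + 2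
  rw [Finset.sum_congr rfl fun i _ => key i, Finset.sum_add_distrib, sum_hit G hab]

/-- kernel: the legs of the external field Ã are untouched by the cut. [cite: Balaban1983Higgs3, (1.17) p.415] -/
theorem numTildeLegs_cutLine (hab : G.other a = some b) (hrest : ∃ x, (x ≠ a ∧ x ≠ b) ∧ (G.other x).isSome) : numTildeLegs (cutLine G a b hab hrest) = numTildeLegs G := rfl

/-- **p. 432 made exact** (every dimension d, graphs without vertices of the form (1.14)–(1.15)): replacing one line by a pair of
external legs raises the degree by EXACTLY `(d − 2) + (number of differentiations acting on the line)` — by (2.1) each endpoint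
leg has dimension −(d−2)/2 when internal and is an external field of dimension 0 afterwards, and a differentiation counts −1 only
*"acting on internal lines"*; cf. `B3LineCut.deg_le_deg_cutLine` (the printed «≥»). [cite: Balaban1983Higgs3, p.432] -/
theorem deg_cutLine_eq (hab : G.other a = some b) (hrest : ∃ x, (x ≠ a ∧ x ≠ b) ∧ (G.other x).isSome) (d : ℕ) (hav : ∀ i, (G.kind i).isAveragingVertex = false) :
    (cutLine G a b hab hrest).deg d = G.deg d + ((d : ℚ) - 2) + (ndiff G a b : ℚ) := by
  have hpt : ∀ i : Fin G.nV, (cutLine G a b hab hrest).vertexDeg d i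
      = G.vertexDeg d i + ((hitS G a b i + hitV G a b i : ℕ) : ℚ) * (((d : ℚ) - 2) / 2) + (diffHit G a b i : ℚ) := by
    intro i
    have hs : (((cutLine G a b hab hrest).intScalar i : ℕ) : ℚ) + (hitS G a b i : ℚ) = G.intScalar i := by
      exact_mod_cast intScalar_cutLine_add G hab hrest i
    have hv : (((cutLine G a b hab hrest).intVector i : ℕ) : ℚ) + (hitV G a b i : ℚ) = G.intVector i := by
      exact_mod_cast intVector_cutLine_add G hab hrest i
    have hδ : (((cutLine G a b hab hrest).intDiffs i : ℕ) : ℚ) + (diffHit G a b i : ℚ) = G.intDiffs i := by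
      exact_mod_cast intDiffs_cutLine_add G hab hrest i
    have e1 := G.vertexDeg_eq d i
    have e2 : (cutLine G a b hab hrest).vertexDeg d i = ((G.kind i).etaCount d : ℚ)
        + (((cutLine G a b hab hrest).intScalar i + (cutLine G a b hab hrest).intVector i : ℕ) : ℚ) * ((2 - (d : ℚ)) / 2)
        - ((cutLine G a b hab hrest).intDiffs i : ℚ)
        + (if (G.kind i).isAveragingVertex then ((cutLine G a b hab hrest).intVector i : ℚ) else 0) :=
      (cutLine G a b hab hrest).vertexDeg_eq d i
    rw [hav i] at e1 e2
    simp only [Bool.false_eq_true, if_false, add_zero] at e1 e2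
    rw [e1, e2]
    push_cast
    linear_combination ((2 - (d : ℚ)) / 2) * (hs + hv) - hδ
  have h2 : (∑ i : Fin G.nV, (((hitS G a b i + hitV G a b i : ℕ) : ℚ))) = 2 := by
    exact_mod_cast sum_hit G hab
  rw [(cutLine G a b hab hrest).deg_eq, G.deg_eq]
  change (∑ i : Fin G.nV, (cutLine G a b hab hrest).vertexDeg d i) - (d : ℚ) = _
  rw [Finset.sum_congr rfl fun i _ => hpt i, Finset.sum_add_distrib, Finset.sum_add_distrib, ← Finset.sum_mul]
  unfold ndiff
  push_cast
  push_cast at h2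
  linear_combination (((d : ℚ) - 2) / 2) * h2

/-! ## d = 3: divergent graphs with at least three external legs have D > −1 -/

/-- d = 3 catalogue fact for a lone vertex, sharpening `B3DivergentGraphs.ext_add_tilde_le_three`: an admissible vertex not of the
form (1.14)–(1.15) with at least two legs on internal lines and D(v) + ext/2 ≤ 2 has ext + (Ã-legs) ≤ 2 ((iii)/(iv) p. 423:
D(v) = n/2 + n′ and ext ≤ n). [cite: Balaban1983Higgs3, p.423] -/
theorem ext_add_tilde_le_two (v : VertexKind) (hv : v.Admissible nbar) (hav : v.isAveragingVertex = false) (ext : ℕ)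
    (hlegs : ext + 2 ≤ v.scalarLegs + v.vectorLegs) (hdeg : degree 3 (toCounts 3 v) + (ext : ℚ) / 2 ≤ 2) :
    ext + v.extVectorLegs ≤ 2 := by
  cases v with
  | v16 => simp [VertexKind.scalarLegs, VertexKind.vectorLegs, VertexKind.extVectorLegs] at hlegs ⊢; omega
  | v17 => simp [VertexKind.scalarLegs, VertexKind.vectorLegs, VertexKind.extVectorLegs] at hlegs ⊢; omega
  | v18 n n' =>
    rw [toCounts_v18, degree_v18] at hdeg
    simp only [VertexKind.scalarLegs, VertexKind.vectorLegs, VertexKind.extVectorLegs] at hlegs ⊢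
    have : (ext : ℚ) ≤ n := by exact_mod_cast (show ext ≤ n by omega)
    have : (ext : ℚ) + n' ≤ 2 := by push_cast at hdeg; linarith
    exact_mod_cast this
  | v19 n nb =>
    rw [toCounts_v19, degree_v18] at hdeg
    simp only [VertexKind.scalarLegs, VertexKind.vectorLegs, VertexKind.extVectorLegs] at hlegs ⊢
    have : (ext : ℚ) ≤ n := by exact_mod_cast (show ext ≤ n by omega)
    have : (ext : ℚ) + (nb + 1) ≤ 2 := by push_cast at hdeg; linarith
    exact_mod_cast this
  | v110 n n' =>
    rw [toCounts_v110, degree_v110] at hdeg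
    simp only [VertexKind.scalarLegs, VertexKind.vectorLegs, VertexKind.extVectorLegs] at hlegs ⊢
    have : (ext : ℚ) ≤ n := by exact_mod_cast (show ext ≤ n by omega)
    have : (ext : ℚ) + n' ≤ 2 := by push_cast at hdeg; linarith
    exact_mod_cast this
  | v111 n nb =>
    rw [toCounts_v111, degree_v110] at hdeg
    simp only [VertexKind.scalarLegs, VertexKind.vectorLegs, VertexKind.extVectorLegs] at hlegs ⊢
    have : (ext : ℚ) ≤ n := by exact_mod_cast (show ext ≤ n by omega)
    have : (ext : ℚ) + (nb + 1) ≤ 2 := by push_cast at hdeg; linarith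
    exact_mod_cast this
  | v113 => simp [VertexKind.scalarLegs, VertexKind.vectorLegs] at hlegs
  | v114 n n' => simp [VertexKind.isAveragingVertex] at hav
  | v115 n nb => simp [VertexKind.isAveragingVertex] at hav

/-- d = 3: a ONE-VERTEX graph with D(G) ≤ −1 (a vertex with a line returning to it) has at most two external legs, Ã included
(cf. `B3DivergentGraphs.ext_le_three_of_nV_eq_one` for D(G) ≤ 0). [cite: Balaban1983Higgs3, p.423] -/
theorem ext_le_two_of_nV_eq_one (hD : G.deg 3 ≤ -1) (hV : G.nV = 1) : G.numExtLegs + numTildeLegs G ≤ 2 := by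
  have hD0 : G.deg 3 ≤ 0 := by linarith
  have hav := isAveragingVertex_eq_false G (not_hasVertex1315_of_deg_nonpos G hD0)
  have hsub : ∀ i j : Fin G.nV, i = j := fun i j => Fin.ext (by omega)
  obtain ⟨⟨i₀, -⟩, -⟩ := G.exists_line
  have huniv : (univ : Finset (Fin G.nV)) = {i₀} := by ext i; simp [hsub i i₀]
  have hE : G.numExtLegs = G.extLegs i₀ := by simp [Graph.numExtLegs, huniv]
  have hT : numTildeLegs G = (G.kind i₀).extVectorLegs := by simp [numTildeLegs, huniv]
  have hint := two_le_int_of_subsingleton G hsub i₀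
  have hlegs : G.extLegs i₀ + 2 ≤ (G.kind i₀).scalarLegs + (G.kind i₀).vectorLegs := by
    have := G.intScalar_le i₀; have := G.intVector_le i₀; unfold Graph.extLegs; omega
  have hdeg : degree 3 (toCounts 3 (G.kind i₀)) + (G.extLegs i₀ : ℚ) / 2 ≤ 2 := by
    have h1 := vertexDeg_eq_degree_add G 3 i₀ (hav i₀)
    have h2 : G.deg 3 = G.vertexDeg 3 i₀ - 3 := by rw [G.deg_eq]; simp [huniv]
    have h3 : (0 : ℚ) ≤ (((G.kind i₀).diffCount - G.intDiffs i₀ : ℕ) : ℚ) := Nat.cast_nonneg _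
    push_cast at h1
    linarith
  rw [hE, hT]
  exact ext_add_tilde_le_two (G.kind i₀) (G.adm i₀) (hav i₀) (G.extLegs i₀) hlegs hdeg

/-- d = 3: a divergent graph (D(G) ≤ 0) with at least THREE external legs, Ã-legs counted, has `D(G) > −1` — by the degree budget of
`B3DivergentGraphs.two_deg_three_eq` such a graph with D ≤ −1 would have one vertex, and then at most two external legs
(`ext_le_two_of_nV_eq_one`). [cite: Balaban1983Higgs3, (2.17) p.429] -/
theorem neg_one_lt_deg_of_three_le_ext (hD : G.deg 3 ≤ 0) (h3 : 3 ≤ G.numExtLegs + numTildeLegs G) : -1 < G.deg 3 := by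
  by_contra hle
  push Not at hle
  have hav := isAveragingVertex_eq_false G (not_hasVertex1315_of_deg_nonpos G hD)
  have hid := two_deg_three_eq G hav
  have hnn : 0 ≤ ∑ i, (2 * degree 3 (toCounts 3 (G.kind i)) - 1 - ((G.kind i).extVectorLegs : ℚ)) :=
    sum_nonneg fun i _ => by linarith [degree_three_ge (G.kind i) (G.adm i) (hav i)]
  have hX : (0 : ℚ) ≤ numExtDiffs G := Nat.cast_nonneg _
  have hV1 : 1 ≤ G.nV := by obtain ⟨x, -⟩ := G.exists_line; exact Fin.pos x.1
  have h3' : (3 : ℚ) ≤ G.numExtLegs + numTildeLegs G := by exact_mod_cast h3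
  have hVle : (G.nV : ℚ) ≤ 1 := by linarith
  have hV : G.nV = 1 := by
    have : G.nV ≤ 1 := by exact_mod_cast hVle
    omega
  have := ext_le_two_of_nV_eq_one G hle hV
  omega

/-! ## The printed sentence, d = 3 -/

/-- **p. 432** [PDF 22], verbatim: *"From our analysis in previous chapters it follows that most of the divergent graphs are
transformed into convergent ones, with the possible exception of graphs with one external vector field leg and vacuum graphs."* —
DECIDED on the model (d = 3, n̄ ≥ 1): let `D(G) ≤ 0` and let G have at least two external legs (Ã-legs counted), i.e. let G be
neither a vacuum graph nor a one-external-leg graph (that leg is then a vector leg: `B3ScalarLegParity`); replace any line of G by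
a pair of external legs (another line remaining).  Then the new graph G′ has `D(G′) > 0`, OR G′ has four external legs and
`D(G′) = 0` — the graph (2.4) (`cutLine_pos_or_is24`). [cite: Balaban1983Higgs3, p.432] -/
theorem deg_cutLine_pos_or (hab : G.other a = some b) (hrest : ∃ x, (x ≠ a ∧ x ≠ b) ∧ (G.other x).isSome) (hn : 1 ≤ nbar) (hD : G.deg 3 ≤ 0) (h2 : 2 ≤ G.numExtLegs + numTildeLegs G) :
    0 < (cutLine G a b hab hrest).deg 3 ∨
      ((cutLine G a b hab hrest).deg 3 = 0
        ∧ (cutLine G a b hab hrest).numExtLegs + numTildeLegs (cutLine G a b hab hrest) = 4) := by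
  have hav := isAveragingVertex_eq_false G (not_hasVertex1315_of_deg_nonpos G hD)
  have hE := numExtLegs_cutLine G hab hrest
  have hT := numTildeLegs_cutLine G hab hrest
  by_cases h3 : 3 ≤ G.numExtLegs + numTildeLegs G
  · left
    have hformula := deg_cutLine_eq G hab hrest 3 hav
    have hnd : (0 : ℚ) ≤ ndiff G a b := Nat.cast_nonneg _
    have hgt := neg_one_lt_deg_of_three_le_ext G hD h3
    norm_num at hformula
    linarith
  · have h2' : G.numExtLegs + numTildeLegs G = 2 := by omega
    by_cases hpos : 0 < (cutLine G a b hab hrest).deg 3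
    · exact Or.inl hpos
    · right
      have hD' : (cutLine G a b hab hrest).deg 3 ≤ 0 := not_lt.mp hpos
      have h4 : (cutLine G a b hab hrest).numExtLegs + numTildeLegs (cutLine G a b hab hrest) = 4 := by
        rw [hE, hT]; omega
      exact ⟨(B3Graph24Unique.graph24_unique (cutLine G a b hab hrest) hn hD' h4).2.2.2.2, h4⟩

/-- **p. 432**, the same with the alternative spelled out by `B3Graph24Unique.graph24_unique` (*"There is only one graph with
four external legs and it is the graph (2.4)"*, p. 429): for a divergent graph with at least two external legs, replacing a line
by a pair of external legs gives either a CONVERGENT graph (`D > 0`) or THE GRAPH (2.4) — two vertices (1.8) with n + n′ = 1,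
each with exactly its differentiated φ′-leg internal, `D = 0`. [cite: Balaban1983Higgs3, p.432] -/
theorem cutLine_pos_or_is24 (hab : G.other a = some b) (hrest : ∃ x, (x ≠ a ∧ x ≠ b) ∧ (G.other x).isSome) (hn : 1 ≤ nbar) (hD : G.deg 3 ≤ 0) (h2 : 2 ≤ G.numExtLegs + numTildeLegs G) :
    0 < (cutLine G a b hab hrest).deg 3 ∨
      ((cutLine G a b hab hrest).nV = 2
        ∧ (∀ i, ∃ n n' : ℕ, (cutLine G a b hab hrest).kind i = .v18 n n' ∧ n + n' = 1)
        ∧ (∀ i, (cutLine G a b hab hrest).intScalar i = 1 ∧ (cutLine G a b hab hrest).intVector i = 0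
          ∧ (cutLine G a b hab hrest).intDiffs i = 1)
        ∧ (cutLine G a b hab hrest).deg 3 = 0) := by
  rcases deg_cutLine_pos_or G hab hrest hn hD h2 with hpos | ⟨hD', h4⟩
  · exact Or.inl hpos
  · obtain ⟨hV, hkind, hinc, -, hdeg⟩ := B3Graph24Unique.graph24_unique (cutLine G a b hab hrest) hn hD'.le h4
    exact Or.inr ⟨hV, hkind, hinc, hdeg⟩

end Literature.MathematicalPhysics.QuantumFieldTheory.Balaban1983to89.B3LineCutDivergent
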